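import Summits.HodgeConjecture.CorCM.MumfordTateRankFive
import Summits.HodgeConjecture.CorCM.MumfordTateRankLeFourHodge
import Literature.AlgebraicGeometry.HodgeTheory.Sl2IsotypicTimesCMProductSpan
import Literature.AlgebraicGeometry.ComplexMultiplication.EndAlgebraDegreeDvdTwoDim
import Literature.AlgebraicGeometry.HodgeTheory.FiniteProductsMixedPowersRetract
import HarnessLib

/-!
# The Hodge side of the rung `dim MT(H¹(X)) = 5`, `X` NOT of CM type: the Hodge conjecture for every complex abelian
# variety with `dim_ℚ Lie Hg(H¹X) = 4` (`Hg = SL₂ × U(1)`), hence for every non-CM `X` with `dim MT(H¹X) ≤ 5`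

COR-CM (cell `pub-hodgecm2`, seat `b27` gen 34, count-neutral lane MT-RANK-FIVE-HODGE; theorems only, no definition, no
named fact; UNCONDITIONAL — nothing here uses or asserts HC_CM).  Sequel of `CorCM/MumfordTateRankFive` (the shape
`X ∼ B^{a+1} × E^{b+1}`, `E` a CM elliptic curve, `B` simple, NOT of CM type, `dim End⁰(B) = (dim B)²`, `dim B ≤ 2`) and of
the Literature lane `HodgeTheory/Sl2IsotypicTimesCM{Invariance,PartialFFT,ProductSpan}` (Lombardo 2016 Lemma 3.4 /
Moonen–Zarhin 1999 (3.1)–(3.2)(2) PROVED for the `𝔰𝔩₂`-isotypic class: `B(B^{N+1} × E^{N+1})` is spanned by exterior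
products of Hodge classes, hence the Hodge conjecture for `B^{N+1} × E^{N+1}`).

* §1 `finrank_add_one_le_of_commute_antirep` (the linear algebra) and **`finrank_hodgeLie_add_one_le_two_mul_dim_of_isSimple`** — for a SIMPLE complex abelian variety `P` with
  `dim_ℚ End⁰(P) = 2 dim P` (QM abelian surfaces, CM elliptic curves, simple CM surfaces …): `dim_ℚ Lie Hg(H¹P) + 1 ≤ 2 dim P`.
  Proof: `Lie Hg` commutes with `End_Hdg(H¹P) ⊇ ρ(End⁰ P)` (Zarhin); `End⁰(P)` is a division algebra (Mumford §19 Cor. 2),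
  so for `v ≠ 0` the orbit map `e ↦ ρ(e) v` is injective, hence onto `H¹` by dimension, and an operator commuting with
  `ρ(End⁰ P)` is determined by its value at `v`: the commutant has dimension `≤ dim H¹ = 2 dim P`, and it contains `1 ∉ Lie Hg`.
  Corollary `not_le_endAlg_and_finrank_hodgeLie_le_three_of_factor`: the non-CM factor of `CorCM/MumfordTateRankFive`
  (`P` simple, not CM, `dim End⁰(P) = (dim P)²`, `dim P ≤ 2`) has `Lie Hg(H¹P) ⊄ End_Hdg` and `dim Lie Hg(H¹P) ≤ 3`.
* §2 domination bookkeeping: a biproduct over an index set with two values is a retract of the binary product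
  (`avDominatedBy_biproduct_prod_of_forall_eq_or`); `P^{a+1} ≼ P^{K+1}` (`a ≤ K`); `A ≼ P ⟹ A^{N+1} ≼ P^{N+1}`;
  `(U × V)^{N+1} ≼ U^{N+1} × V^{N+1}`; `(P^{a+1})^{N+1} ≼ P^{(a+1)(N+1)}`.
* §3 **`hodgeConjectureFor_of_not_isOfCMType_of_finrank_hodgeLie_eq_four`** — the Hodge conjecture for every complex
  abelian variety `X` NOT of CM type with `dim_ℚ Lie Hg(H¹X) = 4`, UNCONDITIONALLY (`X` is dominated by
  `B^{K+1} × E^{K+1}`, whose Hodge conjecture is `hodgeConjectureFor_powSucc_prod_powSucc_of_finrank_hodgeLie_le_three_of_cmCurve`);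
  `…_powSucc_…` — and for ALL ITS POWERS `X^{N+1}`;
  **`hodgeConjectureFor_of_not_isOfCMType_of_mtRank_le_five`** (+ `…_powSucc_…`, `…_of_isIsogenous_powSucc_…`) — the Hodge
  conjecture for EVERY complex abelian variety `X` NOT of CM type with `dim MT(H¹X) ≤ 5`, for all its powers and their
  isogeny classes (with the rung `dim Lie Hg ≤ 3` of `CorCM/MumfordTateRankFourDivisorClasses`).

With `CorCM/MumfordTateRankLeFourHodge` this settles the non-CM half of the ladder through Mumford–Tate rank `5`; the CM half
of rank `5` (`rdim ∈ {4,…,8}`, Weil classes in `H⁶` of simple CM sixfolds of corank one) is open.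

## References
* [MoonenZarhin1999LowDim] B. Moonen, Yu. Zarhin, *Hodge classes on abelian varieties of low dimension*, Math. Ann.
  315 (1999) 711–733, §2 (2.1)–(2.5), §3 (3.1)–(3.2), (3.8).
* [Lombardo2016] D. Lombardo, Ann. Inst. Fourier 66 (2016), Lemma 3.4 (p. 1229).
* [Gordon1999HodgeAVSurvey] B. B. Gordon, *A survey of the Hodge conjecture for abelian varieties*, 7.5–7.7, §7.3.2.
* [MumfordAV1970] D. Mumford, *Abelian Varieties* (1970), §19 Thm. 1, Cor. 2 and p. 174.
* [Zarhin1983HodgeGroupsK3] Yu. G. Zarhin, J. reine angew. Math. 341 (1983), §2.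
-/

noncomputable section

open CategoryTheory CategoryTheory.Limits Module
open scoped BigOperators

namespace Summit.HodgeConjecture.CorCM

open Literature.AlgebraicGeometry.Motives
open Literature.AlgebraicGeometry.Motives.AbelianVariety
open Literature.AlgebraicGeometry.Motives.HodgeStructure
open Literature.AlgebraicGeometry.HodgeTheory
open Literature.AlgebraicGeometry.ComplexMultiplication (nontrivial_endAlgebra_of_dim_pos bettiRep bettiRep_injective
  endAlgebra_exists_inv_of_isSimple)
open Literature.AlgebraicGeometry.Milne1999 (IsOfCMType powProj powLift powLift_powProj pow_hom_ext)
open Literature.AlgebraicGeometry.Pohlmann1968 (isIsogenous_powSucc_biproduct)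
open Summit.HodgeConjecture.CorCM.Domination

variable [HodgeTensorFacts.{0, 0}]

/-! ## §1 The Hodge Lie algebra of a simple abelian variety with `dim End⁰ = 2 dim` -/

section Simple

variable {P : AbelianVariety ℂ}

omit [HodgeTensorFacts.{0, 0}] in
/-- **Linear algebra of the commutant of an anti-representation by a division algebra of the right size.**  Let
`ρ : R → End_ℚ(V)` be `ℚ`-linear, anti-multiplicative and unital (`ρ(ee') = ρ(e')ρ(e)`, `ρ(1) = 1`), every non-zero
element of `R` right-invertible, and `dim_ℚ R = dim_ℚ V`.  Then for `v ≠ 0` the orbit map `e ↦ ρ(e)v` is injective, hence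
onto, so an operator commuting with all `ρ(e)` is determined by its value at `v`: the commutant has dimension `≤ dim V`; a
subspace `W` of operators commuting with `ρ(R)` and NOT containing the identity has `dim W + 1 ≤ dim V`.
[cite: MumfordAV1970, §19 Thm. 1 Cor. 2 (p. 174)] [cite: Zarhin1983HodgeGroupsK3, §2] -/
theorem finrank_add_one_le_of_commute_antirep {R V : Type*} [Ring R] [Algebra ℚ R] [Module.Finite ℚ R]
    [AddCommGroup V] [Module ℚ V] [Module.Finite ℚ V]
    (ρ : R →ₗ[ℚ] Module.End ℚ V) (hmul : ∀ e e', ρ (e * e') = ρ e' * ρ e) (hone : ρ 1 = 1)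
    (hinv : ∀ e : R, e ≠ 0 → ∃ y, e * y = 1) (hdim : Module.finrank ℚ R = Module.finrank ℚ V) {v : V} (hv : v ≠ 0)
    {W : Submodule ℚ (Module.End ℚ V)} (hW : ∀ x ∈ W, ∀ e, x * ρ e = ρ e * x) (hid : LinearMap.id ∉ W) :
    Module.finrank ℚ W + 1 ≤ Module.finrank ℚ V := by
  classical
  -- the orbit map `e ↦ ρ(e) v` is a bijection
  let θ : R →ₗ[ℚ] V := (LinearMap.applyₗ v) ∘ₗ ρ
  have hθ : ∀ e, θ e = ρ e v := fun e => rfl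
  have hθinj : Function.Injective θ := by
    rw [injective_iff_map_eq_zero]
    intro e he
    by_contra hne
    obtain ⟨y, hey⟩ := hinv e hne
    apply hv
    have h1 : ρ y (ρ e v) = v := by
      rw [← Module.End.mul_apply, ← hmul, hey, hone, Module.End.one_apply]
    rw [← h1, ← hθ, he, map_zero]
  have hθsurj : Function.Surjective θ := by
    have hr : Module.finrank ℚ (LinearMap.range θ) = Module.finrank ℚ V := by
      rw [LinearMap.finrank_range_of_inj hθinj, hdim]
    exact LinearMap.range_eq_top.1 (Submodule.eq_top_of_finrank_eq hr)
  -- the commutant embeds into `V` by evaluation at `v`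
  let C : Submodule ℚ (Module.End ℚ V) := Subalgebra.toSubmodule (Subalgebra.centralizer ℚ (Set.range ρ))
  have hCmem : ∀ x, x ∈ C ↔ ∀ e, ρ e * x = x * ρ e := fun x => by
    change x ∈ Subalgebra.centralizer ℚ (Set.range ρ) ↔ _
    rw [Subalgebra.mem_centralizer_iff]
    exact ⟨fun h e => h _ ⟨e, rfl⟩, fun h g hg => by obtain ⟨e, rfl⟩ := hg; exact h e⟩
  let ev : C →ₗ[ℚ] V := (LinearMap.applyₗ v) ∘ₗ C.subtype
  have hevinj : Function.Injective ev := by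
    rw [injective_iff_map_eq_zero]
    rintro ⟨x, hx⟩ hx0
    change x v = 0 at hx0
    rw [hCmem] at hx
    refine Subtype.ext (LinearMap.ext fun w => ?_)
    obtain ⟨e, rfl⟩ := hθsurj w
    change x (θ e) = (0 : Module.End ℚ V) (θ e)
    rw [hθ, LinearMap.zero_apply, ← Module.End.mul_apply, ← hx e, Module.End.mul_apply, hx0, map_zero]
  have hCle : Module.finrank ℚ C ≤ Module.finrank ℚ V := LinearMap.finrank_le_finrank_of_injective hevinj
  -- `W < C`
  have hle : W ≤ C := fun x hx => (hCmem x).2 fun e => (hW x hx e).symm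
  have hlt : W < C := by
    refine lt_of_le_of_ne hle fun heq => hid ?_
    rw [heq, hCmem]
    intro e
    rw [show (LinearMap.id : Module.End ℚ V) = 1 from rfl, mul_one, one_mul]
  exact Nat.succ_le_of_lt (lt_of_lt_of_le (Submodule.finrank_lt_finrank_of_lt hlt) hCle)

/-- **`dim_ℚ Lie Hg(H¹P) + 1 ≤ 2 dim P` for `P` simple with `dim_ℚ End⁰(P) = 2 dim P`** (in particular `dim Lie Hg ≤ 3` for an
abelian surface with quaternionic multiplication).  `Lie Hg` commutes with the Hodge endomorphisms `ρ(e) = e^*`, `e ∈ End⁰(P)`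
(Zarhin; Riemann: `unop_bettiRep_mem_endAlg`); `End⁰(P)` is a division algebra (Mumford §19 Cor. 2) of dimension `dim H¹`, and
`1 ∉ Lie Hg` (`id_notMem_hodgeLie`): the previous lemma. [cite: MumfordAV1970, §19 Thm. 1 Cor. 2 (p. 174)]
[cite: Zarhin1983HodgeGroupsK3, §2] [cite: MoonenZarhin1999LowDim, §2 (2.2)] -/
theorem finrank_hodgeLie_add_one_le_two_mul_dim_of_isSimple (hS : P.IsSimple) (h0 : 0 < P.dim)
    (hd : Module.finrank ℚ P.endAlgebra = 2 * P.dim) :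
    haveI := BettiUniverse.finite (AbelianVariety.isSmoothProjective_holds (A := P)) 1
    Module.finrank ℚ (BettiUniverse.hodge exists_isReal_hodgeModel_holds
      (AbelianVariety.isSmoothProjective_holds (A := P)) 1).hodgeLie + 1 ≤ 2 * P.dim := by
  classical
  haveI := BettiUniverse.finite (AbelianVariety.isSmoothProjective_holds (A := P)) 1
  haveI : Nontrivial (bettiCohomology P.X 1) := nontrivial_bettiCohomology_one h0
  haveI : Nontrivial P.endAlgebra := nontrivial_endAlgebra_of_dim_pos h0
  haveI : Module.Finite ℚ P.endAlgebra := finiteDimensional_endAlgebra_holds P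
  obtain ⟨ψ⟩ := BettiUniverse.hodge_isPolarizable exists_isReal_hodgeModel_holds
    (AbelianVariety.isSmoothProjective_holds (A := P)) 1
  obtain ⟨v, hv⟩ := exists_ne (0 : bettiCohomology P.X 1)
  have h := finrank_add_one_le_of_commute_antirep (V := bettiCohomology P.X 1)
    (((MulOpposite.opLinearEquiv ℚ).symm :
        (Module.End ℚ (bettiCohomology P.X 1))ᵐᵒᵖ ≃ₗ[ℚ] Module.End ℚ (bettiCohomology P.X 1)).toLinearMap ∘ₗ
      (bettiRep P).toLinearMap)
    (fun e e' => by
      change MulOpposite.unop (bettiRep P (e * e')) = MulOpposite.unop (bettiRep P e') * MulOpposite.unop (bettiRep P e)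
      rw [map_mul, MulOpposite.unop_mul])
    (by change MulOpposite.unop (bettiRep P 1) = 1; rw [map_one, MulOpposite.unop_one])
    (fun e he => (endAlgebra_exists_inv_of_isSimple hS e he).imp fun y hy => hy.1)
    (by rw [hd, finrank_bettiCohomology_one]) hv
    (W := (BettiUniverse.hodge exists_isReal_hodgeModel_holds (AbelianVariety.isSmoothProjective_holds (A := P)) 1).hodgeLie)
    (fun x hx e => commute_of_mem_hodgeLie _ hx
      ⟨_, unop_bettiRep_mem_endAlg exists_isReal_hodgeModel_holds hodgePQ_independent_of_hodgeModel_holds e⟩)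
    (id_notMem_hodgeLie _ ψ)
  rw [finrank_bettiCohomology_one] at h
  exact h

/-- **The non-CM factor of the rank-five shape is of Hodge-group rank three**: a SIMPLE complex abelian variety `P` NOT of
CM type with `dim_ℚ End⁰(P) = (dim P)²` and `0 < dim P ≤ 2` (a non-CM elliptic curve, or an abelian surface with quaternionic
multiplication) has `Lie Hg(H¹P) ⊄ End_Hdg(H¹P)` and `dim_ℚ Lie Hg(H¹P) ≤ 3` — the hypotheses of the Literature lane
`Sl2Isotypic*`.  (`dim P = 1`: `dim MT = 4`, `CorCM/MumfordTateRankFour`; `dim P = 2`: the previous theorem.)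
[cite: MoonenZarhin1999LowDim, §2 (2.1)–(2.2)] [cite: Gordon1999HodgeAVSurvey, §7.3.2] -/
theorem not_le_endAlg_and_finrank_hodgeLie_le_three_of_factor (hS : P.IsSimple) (h0 : 0 < P.dim)
    (hcm : ¬ IsOfCMType P) (hd : Module.finrank ℚ P.endAlgebra = P.dim ^ 2) (h2 : P.dim ≤ 2) :
    haveI := BettiUniverse.finite (AbelianVariety.isSmoothProjective_holds (A := P)) 1
    ¬ (BettiUniverse.hodge exists_isReal_hodgeModel_holds (AbelianVariety.isSmoothProjective_holds (A := P)) 1).hodgeLie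
        ≤ Subalgebra.toSubmodule
          (BettiUniverse.hodge exists_isReal_hodgeModel_holds (AbelianVariety.isSmoothProjective_holds (A := P)) 1).endAlg ∧
      Module.finrank ℚ (BettiUniverse.hodge exists_isReal_hodgeModel_holds
        (AbelianVariety.isSmoothProjective_holds (A := P)) 1).hodgeLie ≤ 3 := by
  haveI := BettiUniverse.finite (AbelianVariety.isSmoothProjective_holds (A := P)) 1
  haveI : Nontrivial (bettiCohomology P.X 1) := nontrivial_bettiCohomology_one h0
  obtain ⟨ψ⟩ := BettiUniverse.hodge_isPolarizable exists_isReal_hodgeModel_holds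
    (AbelianVariety.isSmoothProjective_holds (A := P)) 1
  have hne : ¬ (BettiUniverse.hodge exists_isReal_hodgeModel_holds (AbelianVariety.isSmoothProjective_holds (A := P)) 1).hodgeLie
      ≤ Subalgebra.toSubmodule
        (BettiUniverse.hodge exists_isReal_hodgeModel_holds (AbelianVariety.isSmoothProjective_holds (A := P)) 1).endAlg :=
    fun h => hcm ((isOfCMType_iff_mumfordTateLieAlgebra_le_endAlg
      (AbelianVariety.isSmoothProjective_holds (A := P))).2 ((hodgeLie_le_endAlg_iff _).1 h))
  refine ⟨hne, ?_⟩
  rcases (show P.dim = 1 ∨ P.dim = 2 by omega) with h1 | h2'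
  · have h4 := mtRank_hodge_one_eq_four_of_dim_one (AbelianVariety.isSmoothProjective_holds (A := P)) h1 hcm
    have hle := finrank_hodgeLie_add_one_le_mtRank
      (BettiUniverse.hodge exists_isReal_hodgeModel_holds (AbelianVariety.isSmoothProjective_holds (A := P)) 1) ψ (by simp)
    omega
  · have hd' : Module.finrank ℚ P.endAlgebra = 2 * P.dim := by rw [hd, h2']; norm_num
    have h := finrank_hodgeLie_add_one_le_two_mul_dim_of_isSimple hS h0 hd'
    omega

end Simple

/-! ## §2 Domination bookkeeping: two-valued biproducts, truncation of powers -/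

section Domination

omit [HodgeTensorFacts.{0, 0}] in
/-- **A biproduct over an index set taking two values is a retract of the binary product**: if every `l` is `i` or `j`
(`i ≠ j`), then `⨁_l G_l ≼ G_i × G_j` (`(π_i, π_j)` and `pr₁ ≫ ι_i + pr₂ ≫ ι_j` compose to `Σ_l π_l ≫ ι_l = 𝟙`).
[cite: MumfordAV1970, §19 (Hom(C, A × B) = Hom(C, A) ⊕ Hom(C, B))] -/
theorem avDominatedBy_biproduct_prod_of_forall_eq_or {r : ℕ} (G : Fin r → AbelianVariety ℂ) {i j : Fin r} (hij : i ≠ j)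
    (hall : ∀ l, l = i ∨ l = j) : AVDominatedBy (⨁ G) ((G i).prod (G j)) := by
  classical
  refine ⟨AbelianVariety.prodLift (biproduct.π G i) (biproduct.π G j),
    AbelianVariety.fst _ _ ≫ biproduct.ι G i + AbelianVariety.snd _ _ ≫ biproduct.ι G j, 1, one_ne_zero, ?_⟩
  rw [one_smul, Preadditive.comp_add, ← Category.assoc, ← Category.assoc, AbelianVariety.prodLift_fst,
    AbelianVariety.prodLift_snd]
  have huniv : (Finset.univ : Finset (Fin r)) = {i, j} := by
    ext l
    simp only [Finset.mem_univ, Finset.mem_insert, Finset.mem_singleton, true_iff]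
    exact hall l
  have htot := biproduct.total (f := G)
  rw [huniv, Finset.sum_pair hij] at htot
  exact htot

omit [HodgeTensorFacts.{0, 0}] in
/-- **`P^{a+1}` is a retract of `P^{K+1}` for `a ≤ K`** (the first `a + 1` coordinates).
[cite: MumfordAV1970, §19 (Hom(C, A × B) = Hom(C, A) ⊕ Hom(C, B))] -/
theorem avDominatedBy_powSucc_of_le (P : AbelianVariety ℂ) {a K : ℕ} (haK : a ≤ K) :
    AVDominatedBy (P.powSucc a) (P.powSucc K) := by
  refine ⟨powLift K fun r => powProj P a ⟨min (r : ℕ) a, by omega⟩,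
    powLift a fun s => powProj P K (s.castLE (by omega)), 1, one_ne_zero, ?_⟩
  rw [one_smul]
  refine pow_hom_ext a fun s => ?_
  rw [Category.assoc, powLift_powProj, powLift_powProj, Category.id_comp]
  congr 1
  ext
  simp only [Fin.val_castLE]
  exact Nat.min_eq_left (by have := s.2; omega)

omit [HodgeTensorFacts.{0, 0}] in
/-- A biproduct of copies `⨁_{Fin (a+1)} P` is dominated by every `P^{K+1}`, `a ≤ K`. [cite: MumfordAV1970, §19] -/
theorem avDominatedBy_biproduct_const_powSucc (P : AbelianVariety ℂ) {a K : ℕ} (haK : a ≤ K) :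
    AVDominatedBy (⨁ fun _ : Fin (a + 1) => P) (P.powSucc K) :=
  (AVDominatedBy.of_isIsogenous (isIsogenous_powSucc_biproduct P a).symm' (AVDominatedBy.refl _)).trans
    (avDominatedBy_powSucc_of_le P haK)

omit [HodgeTensorFacts.{0, 0}] in
/-- **Powers of a domination**: `A ≼ P` gives `A^{N+1} ≼ P^{N+1}` (componentwise maps; `[n]^{N+1} = [n]`).
[cite: MumfordAV1970, §19 (Hom(C, A × B) = Hom(C, A) ⊕ Hom(C, B))] -/
theorem avDominatedBy_powSucc_of_avDominatedBy {A P : AbelianVariety ℂ} (h : AVDominatedBy A P) (N : ℕ) :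
    AVDominatedBy (A.powSucc N) (P.powSucc N) := by
  obtain ⟨s, π, n, hn, hsπ⟩ := h
  refine ⟨powSuccMap s N, powSuccMap π N, n, hn, pow_hom_ext _ fun r => ?_⟩
  rw [Category.assoc, powSuccMap_powProj, ← Category.assoc, powSuccMap_powProj, Category.assoc, hsπ,
    Preadditive.comp_nsmul, Category.comp_id, Preadditive.nsmul_comp, Category.id_comp]

omit [HodgeTensorFacts.{0, 0}] in
/-- **`(U × V)^{N+1} ≼ U^{N+1} × V^{N+1}`** (the regrouping `((u_r, v_r))_r ↦ ((u_r)_r, (v_r)_r)` and back compose to the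
identity). [cite: MumfordAV1970, §19 (Hom(C, A × B) = Hom(C, A) ⊕ Hom(C, B))] -/
theorem avDominatedBy_powSucc_prod (U V : AbelianVariety ℂ) (N : ℕ) :
    AVDominatedBy ((U.prod V).powSucc N) ((U.powSucc N).prod (V.powSucc N)) := by
  refine ⟨AbelianVariety.prodLift (powSuccMap (AbelianVariety.fst U V) N) (powSuccMap (AbelianVariety.snd U V) N),
    powLift N fun r => AbelianVariety.prodLift (AbelianVariety.fst _ _ ≫ powProj U N r)
      (AbelianVariety.snd _ _ ≫ powProj V N r), 1, one_ne_zero, ?_⟩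
  rw [one_smul]
  refine pow_hom_ext _ fun r => ?_
  rw [Category.assoc, powLift_powProj, Category.id_comp]
  apply AbelianVariety.prod_hom_ext
  · rw [Category.assoc, AbelianVariety.prodLift_fst, ← Category.assoc, AbelianVariety.prodLift_fst, powSuccMap_powProj]
  · rw [Category.assoc, AbelianVariety.prodLift_snd, ← Category.assoc, AbelianVariety.prodLift_snd, powSuccMap_powProj]

omit [HodgeTensorFacts.{0, 0}] in
/-- **`(P^{a+1})^{N+1} ≼ P^{(a+1)(N+1)}`** (the regrouping retract `powPowIncl ≫ powPowProj = 𝟙` of the tree).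
[cite: MumfordAV1970, §19 (Hom(C, A × B) = Hom(C, A) ⊕ Hom(C, B))] -/
theorem avDominatedBy_powSucc_powSucc (P : AbelianVariety ℂ) (a N : ℕ) :
    AVDominatedBy ((P.powSucc a).powSucc N) (P.powSucc (a + N * (a + 1))) :=
  ⟨powPowIncl P a N, powPowProj P a N, 1, one_ne_zero, by rw [powPowIncl_comp_powPowProj, one_smul]⟩

end Domination

/-! ## §3 The Hodge conjecture in Mumford–Tate rank five, non-CM -/

section RankFive

variable {X : AbelianVariety ℂ} {n : ℕ}

/-- **The Hodge conjecture for every complex abelian variety `X` NOT of CM type with `dim_ℚ Lie Hg(H¹(X)) = 4`**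
(`Hg = SL₂ × U(1)`, Moonen–Zarhin), UNCONDITIONALLY.  By `exists_isIsogenous_two_powers_of_finrank_hodgeLie_eq_four`,
`X ∼ B^{a+1} × E^{b+1}` with `E` a CM elliptic curve and `B` simple, not CM, `dim End⁰(B) = (dim B)²`, `dim B ≤ 2`; so `X`
is dominated by `B^{K+1} × E^{K+1}` (`K = max a b`), which satisfies the Hodge conjecture by the `𝔰𝔩₂`-isotypic product
theorem `hodgeConjectureFor_powSucc_prod_powSucc_of_finrank_hodgeLie_le_three_of_cmCurve` (Lombardo 3.4 / Moonen–Zarhin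
(3.2)(2) proved for this class, Murty for `B^{K+1}`, Tate for `E^{K+1}`), and the Hodge conjecture descends along
dominations. [cite: MoonenZarhin1999LowDim, §2 (2.1)–(2.5) and §3 (3.2), (3.8)] [cite: Lombardo2016, Lemma 3.4 (p. 1229)]
[cite: Gordon1999HodgeAVSurvey, 7.5 and §7.3.2] [cite: MumfordAV1970, §19 Thm. 1 and p. 174] -/
theorem hodgeConjectureFor_of_not_isOfCMType_of_finrank_hodgeLie_eq_four (hX : IsSmoothProjective n X.X)
    (hcm : ¬ IsOfCMType X)
    (h4 : haveI := BettiUniverse.finite hX 1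
      Module.finrank ℚ (BettiUniverse.hodge exists_isReal_hodgeModel_holds hX 1).hodgeLie = 4) :
    HodgeConjectureFor X.dim X.X := by
  classical
  obtain ⟨r, B, nB, i, j, hS, hd, -, hXB, hij, hall, hcmi, hEi, hdimi, hdj1, -, hcmj⟩ :=
    exists_isIsogenous_two_powers_of_finrank_hodgeLie_eq_four hX hcm h4
  obtain ⟨hneP, h3P⟩ := not_le_endAlg_and_finrank_hodgeLie_le_three_of_factor (hS i) (hd i) hcmi hEi hdimi
  set K := max (nB i) (nB j) with hK
  have hdom : AVDominatedBy X (((B i).powSucc K).prod ((B j).powSucc K)) :=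
    (AVDominatedBy.of_isIsogenous hXB (AVDominatedBy.refl _)).trans
      ((avDominatedBy_biproduct_prod_of_forall_eq_or (fun l => ⨁ fun _ : Fin (nB l + 1) => B l) hij hall).trans
        ((avDominatedBy_biproduct_const_powSucc (B i) (le_max_left _ _)).prod
          (avDominatedBy_biproduct_const_powSucc (B j) (le_max_right _ _))))
  exact hodgeConjectureFor_of_avDominatedBy
    (hodgeConjectureFor_powSucc_prod_powSucc_of_finrank_hodgeLie_le_three_of_cmCurve hneP h3P hdj1 hcmj K) hdom

/-- **… and for ALL POWERS `X^{N+1}`** of a complex abelian variety `X` NOT of CM type with `dim_ℚ Lie Hg(H¹(X)) = 4`,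
UNCONDITIONALLY: `X^{N+1} ≼ (B^{K+1} × E^{K+1})^{N+1} ≼ (B^{K+1})^{N+1} × (E^{K+1})^{N+1} ≼ B^{K'+1} × E^{K'+1}`,
`K' = K + N(K+1)`, and the last satisfies the Hodge conjecture (`𝔰𝔩₂`-isotypic product theorem).  In Hazama's language `X`
is «stably Hodge» (not stably nondegenerate in general: `B•((B × E)ⁿ) ≠ D•` when `B` is a QM surface?  — no claim is made
about divisor generation here). [cite: MoonenZarhin1999LowDim, §2 and §3 (3.2), (3.8)] [cite: Gordon1999HodgeAVSurvey, 7.6.1]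
[cite: MumfordAV1970, §19 Thm. 1 and p. 174] -/
theorem hodgeConjectureFor_powSucc_of_not_isOfCMType_of_finrank_hodgeLie_eq_four (hX : IsSmoothProjective n X.X)
    (hcm : ¬ IsOfCMType X)
    (h4 : haveI := BettiUniverse.finite hX 1
      Module.finrank ℚ (BettiUniverse.hodge exists_isReal_hodgeModel_holds hX 1).hodgeLie = 4) (N : ℕ) :
    HodgeConjectureFor (X.powSucc N).dim (X.powSucc N).X := by
  classical
  obtain ⟨r, B, nB, i, j, hS, hd, -, hXB, hij, hall, hcmi, hEi, hdimi, hdj1, -, hcmj⟩ :=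
    exists_isIsogenous_two_powers_of_finrank_hodgeLie_eq_four hX hcm h4
  obtain ⟨hneP, h3P⟩ := not_le_endAlg_and_finrank_hodgeLie_le_three_of_factor (hS i) (hd i) hcmi hEi hdimi
  set K := max (nB i) (nB j) with hK
  have hdom : AVDominatedBy X (((B i).powSucc K).prod ((B j).powSucc K)) :=
    (AVDominatedBy.of_isIsogenous hXB (AVDominatedBy.refl _)).trans
      ((avDominatedBy_biproduct_prod_of_forall_eq_or (fun l => ⨁ fun _ : Fin (nB l + 1) => B l) hij hall).trans
        ((avDominatedBy_biproduct_const_powSucc (B i) (le_max_left _ _)).prod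
          (avDominatedBy_biproduct_const_powSucc (B j) (le_max_right _ _))))
  have hdomN : AVDominatedBy (X.powSucc N)
      (((B i).powSucc (K + N * (K + 1))).prod ((B j).powSucc (K + N * (K + 1)))) :=
    (avDominatedBy_powSucc_of_avDominatedBy hdom N).trans ((avDominatedBy_powSucc_prod _ _ N).trans
      ((avDominatedBy_powSucc_powSucc (B i) K N).prod (avDominatedBy_powSucc_powSucc (B j) K N)))
  exact hodgeConjectureFor_of_avDominatedBy
    (hodgeConjectureFor_powSucc_prod_powSucc_of_finrank_hodgeLie_le_three_of_cmCurve hneP h3P hdj1 hcmj _) hdomN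

/-- **The Hodge conjecture for EVERY complex abelian variety `X` NOT of CM type with `dim MT(H¹(X)) ≤ 5`**, UNCONDITIONALLY:
`dim Lie Hg + 1 ≤ dim MT ≤ 5`; if `dim Lie Hg ≤ 3` this is Murty's rung (`CorCM/MumfordTateRankFourDivisorClasses`,
`B = D`), else `dim Lie Hg = 4` and the previous theorem applies. [cite: MoonenZarhin1999LowDim, §2 (2.1)–(2.5) and §3 (3.2)]
[cite: Gordon1999HodgeAVSurvey, 7.5 and §7.3.2] -/
theorem hodgeConjectureFor_of_not_isOfCMType_of_mtRank_le_five (hX : IsSmoothProjective n X.X) (h0 : 0 < X.dim)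
    (hcm : ¬ IsOfCMType X)
    (h5 : haveI := BettiUniverse.finite hX 1
      (BettiUniverse.hodge exists_isReal_hodgeModel_holds hX 1).mtRank ≤ 5) :
    HodgeConjectureFor X.dim X.X := by
  have hn : X.dim = n := schemeDim_eq_holds hX
  subst hn
  haveI := BettiUniverse.finite hX 1
  haveI : Nontrivial (bettiCohomology X.X 1) := nontrivial_bettiCohomology_one h0
  obtain ⟨ψ⟩ := BettiUniverse.hodge_isPolarizable exists_isReal_hodgeModel_holds hX 1
  have hne : ¬ (BettiUniverse.hodge exists_isReal_hodgeModel_holds hX 1).hodgeLie ≤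
      Subalgebra.toSubmodule (BettiUniverse.hodge exists_isReal_hodgeModel_holds hX 1).endAlg := fun h =>
    hcm ((isOfCMType_iff_mumfordTateLieAlgebra_le_endAlg hX).2 ((hodgeLie_le_endAlg_iff _).1 h))
  have hle := finrank_hodgeLie_add_one_le_mtRank (BettiUniverse.hodge exists_isReal_hodgeModel_holds hX 1) ψ (by simp)
  by_cases h3 : Module.finrank ℚ (BettiUniverse.hodge exists_isReal_hodgeModel_holds hX 1).hodgeLie ≤ 3
  · exact (avSlots_self X).hodgeConjectureFor_of_finrank_hodgeLie_le_three hne h3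
  · have h4 : Module.finrank ℚ (BettiUniverse.hodge exists_isReal_hodgeModel_holds hX 1).hodgeLie = 4 := by omega
    exact hodgeConjectureFor_of_not_isOfCMType_of_finrank_hodgeLie_eq_four hX hcm h4

/-- **… and for ALL POWERS**: every power `X^{N+1}` of a complex abelian variety `X` NOT of CM type with
`dim MT(H¹(X)) ≤ 5` satisfies the Hodge conjecture, UNCONDITIONALLY (`dim Lie Hg ≤ 3`: all powers have `B = D`,
`CorCM/MumfordTateRankFourDivisorClasses`; `dim Lie Hg = 4`: the previous theorem). [cite: MoonenZarhin1999LowDim, §2 and §3 (3.2)]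
[cite: Gordon1999HodgeAVSurvey, 7.5–7.6 and §7.3.2] -/
theorem hodgeConjectureFor_powSucc_of_not_isOfCMType_of_mtRank_le_five (hX : IsSmoothProjective n X.X) (h0 : 0 < X.dim)
    (hcm : ¬ IsOfCMType X)
    (h5 : haveI := BettiUniverse.finite hX 1
      (BettiUniverse.hodge exists_isReal_hodgeModel_holds hX 1).mtRank ≤ 5) (N : ℕ) :
    HodgeConjectureFor (X.powSucc N).dim (X.powSucc N).X := by
  have hn : X.dim = n := schemeDim_eq_holds hX
  subst hn
  haveI := BettiUniverse.finite hX 1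
  haveI : Nontrivial (bettiCohomology X.X 1) := nontrivial_bettiCohomology_one h0
  obtain ⟨ψ⟩ := BettiUniverse.hodge_isPolarizable exists_isReal_hodgeModel_holds hX 1
  have hne : ¬ (BettiUniverse.hodge exists_isReal_hodgeModel_holds hX 1).hodgeLie ≤
      Subalgebra.toSubmodule (BettiUniverse.hodge exists_isReal_hodgeModel_holds hX 1).endAlg := fun h =>
    hcm ((isOfCMType_iff_mumfordTateLieAlgebra_le_endAlg hX).2 ((hodgeLie_le_endAlg_iff _).1 h))
  have hle := finrank_hodgeLie_add_one_le_mtRank (BettiUniverse.hodge exists_isReal_hodgeModel_holds hX 1) ψ (by simp)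
  by_cases h3 : Module.finrank ℚ (BettiUniverse.hodge exists_isReal_hodgeModel_holds hX 1).hodgeLie ≤ 3
  · exact (AVSlots.powSucc X N).hodgeConjectureFor_of_finrank_hodgeLie_le_three hne h3
  · have h4 : Module.finrank ℚ (BettiUniverse.hodge exists_isReal_hodgeModel_holds hX 1).hodgeLie = 4 := by omega
    exact hodgeConjectureFor_powSucc_of_not_isOfCMType_of_finrank_hodgeLie_eq_four hX hcm h4 N

/-- **The isogeny classes of the powers**: every complex abelian variety isogenous to some `X^{N+1}`, `X` NOT of CM type
with `dim MT(H¹(X)) ≤ 5`, satisfies the Hodge conjecture (van Geemen Lemma 3.7). [cite: vanGeemen1994HodgeAV, §3.5–3.7 Lemma 3.7]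
[cite: MoonenZarhin1999LowDim, §2 and §3 (3.2)] -/
theorem hodgeConjectureFor_of_isIsogenous_powSucc_of_not_isOfCMType_of_mtRank_le_five (hX : IsSmoothProjective n X.X)
    (h0 : 0 < X.dim) (hcm : ¬ IsOfCMType X)
    (h5 : haveI := BettiUniverse.finite hX 1
      (BettiUniverse.hodge exists_isReal_hodgeModel_holds hX 1).mtRank ≤ 5)
    {A : AbelianVariety ℂ} {N : ℕ} (hA : A.IsIsogenous (X.powSucc N)) : HodgeConjectureFor A.dim A.X :=
  HodgeConjectureFor.of_isIsogenous hA (hodgeConjectureFor_powSucc_of_not_isOfCMType_of_mtRank_le_five hX h0 hcm h5 N)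

end RankFive

end Summit.HodgeConjecture.CorCM

end
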